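import Summits.NavierStokesRegularity.FluidComputer.RowDefectSound
import Summits.NavierStokesRegularity.FluidComputer.RowStages
import HarnessLib

/-!
# Enclosure soundness I: the reference, its derivative, the Jacobian and `P̃` on an interval
# (`pub-fluidc-bp3/R1-DESIGN.md` §9.2 / §9.4, layer B of `structure Row`)

HONEST FRAMING (cell `pub-fluidc`, blueprint seat bp3, gen 20): low prior, high value-of-information
experiment on Tao's machine paradigm; NOT a claim that NS blows up. Interval bookkeeping only.

The row check evaluates the reference centre `x̂ = Σ CQ_m u^m`, its derivative, the Jacobian
`J(x̂)` and the lock projector `P̃ = I − x̂' e_pᵀ/x̂'_p` in interval arithmetic on a time interval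
`V ∋ u` (`U = [0,H]` or a sub-interval). This file proves that those interval tables ENCLOSE the real
objects of `RowModel`: `mem_ofFrac`, `mem_eyeI`, `mem_mulT` (generic); `mem_U`;
`mem_XIon : u ∈ V → x̂(u) ∈ XIon V`; `xhd_eq_sum` and `mem_DXIon : x̂'(u) ∈ DXIon V`;
`mem_JI : J(x̂(u)) ∈ JmatI(XIon V)`; `mem_sInv` (the signed reciprocal of a sign-definite interval)
and `mem_PT : P̃(u) ∈ PT`; and the two `Cert` fields that only need the whole-row interval `U`:
`hΦ` (`|Φ|_lo ≤ |x̂'_p|`, from sign-definiteness) and `hJp` (`|J_{pb}(x̂)| ≤ |J|_{pb}`).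

[cite: Tao2016AveragedNS, §5.5 Thm 5.3 (5.5)]
-/

namespace Summit.NavierStokesRegularity.FluidComputer

open Literature.Analysis.FluidPDE.FluidComputer
open Literature.Analysis.ValidatedNumerics.Numerics (cdiv div_le_cdiv le_cdiv_mul_real)

namespace RowCheck

open DIVec ChainField Finset Real Polynomial Set

/-! ### Generic memberships -/

/-- `q ∈ ofFrac P q`. [folklore] -/
theorem mem_ofFrac (P : ℕ) (q : ℚ) : (ofFrac P q).mem P (q : ℝ) := by
  refine ⟨?_, ?_⟩
  · have h := Int.floor_le (q * 2 ^ P)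
    have h' : ((⌊q * 2 ^ P⌋ : ℤ) : ℝ) ≤ ((q * 2 ^ P : ℚ) : ℝ) := by exact_mod_cast h
    simpa [ofFrac] using h'
  · have h := Int.le_ceil (q * 2 ^ P)
    have h' : ((q * 2 ^ P : ℚ) : ℝ) ≤ ((⌈q * 2 ^ P⌉ : ℤ) : ℝ) := by exact_mod_cast h
    simpa [ofFrac] using h'

/-- The identity matrix entry is in `eyeI`. [folklore] -/
theorem mem_eyeI (P : ℕ) {n : ℕ} (i j : Fin n) :
    (eyeI P i j).mem P (if i = j then (1 : ℝ) else 0) := by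
  unfold eyeI
  split_ifs
  · have := DI.mem_pt P (one P)
    simpa [DI.pt, one] using this
  · simpa using DI.mem_pt P 0

/-- Tabulated interval matrix product encloses the real product. [folklore] -/
theorem mem_mulT (P : ℕ) {n m l : ℕ} {A : Tab DI n m} {B : Tab DI m l}
    {M : Matrix (Fin n) (Fin m) ℝ} {N : Matrix (Fin m) (Fin l) ℝ}
    (hA : ∀ i j, (A.at i j).mem P (M i j)) (hB : ∀ j k, (B.at j k).mem P (N j k)) (i : Fin n)
    (k : Fin l) : ((mulT P A B).at i k).mem P ((M * N) i k) := by
  rw [mulT, Tab.at_mk']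
  exact mem_mul P hA hB i k

/-- The hull is symmetric. [folklore] -/
theorem hull_comm (I J : DI) : I.hull J = J.hull I := by
  simp [DI.hull, min_comm, max_comm]

/-- A number between two members (in either order) is in the hull. [folklore] -/
theorem mem_hull_between {P : ℕ} {I J : DI} {x y z : ℝ} (hx : I.mem P x) (hz : J.mem P z)
    (h : (x ≤ y ∧ y ≤ z) ∨ (z ≤ y ∧ y ≤ x)) : (I.hull J).mem P y := by
  rcases h with ⟨h1, h2⟩ | ⟨h1, h2⟩
  · exact DI.mem_hull_of_between hx hz h1 h2
  · rw [hull_comm]; exact DI.mem_hull_of_between hz hx h1 h2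

/-- An affine function of `v ∈ [v₀, v₁]` lies between its endpoint values. [folklore] -/
theorem affine_between (a d v v₀ v₁ : ℝ) (h0 : v₀ ≤ v) (h1 : v ≤ v₁) :
    (a + v₀ * d ≤ a + v * d ∧ a + v * d ≤ a + v₁ * d) ∨
      (a + v₁ * d ≤ a + v * d ∧ a + v * d ≤ a + v₀ * d) := by
  rcases le_or_gt 0 d with hd | hd
  · left; constructor <;> nlinarith
  · right; constructor <;> nlinarith

namespace RowData

variable (r : RowData)

/-! ### The row interval and the reference -/

/-- `u ∈ [0, H]` is in `U`. [folklore] -/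
theorem mem_U {u : ℝ} (hu : u ∈ Icc 0 (r.Hq : ℝ)) : r.U.mem r.P u := by
  refine ⟨?_, ?_⟩
  · simp only [U, Int.cast_zero]
    exact mul_nonneg hu.1 (by positivity)
  · simp only [U]
    have h := Int.le_ceil (r.Hq * 2 ^ r.P)
    have h' : ((r.Hq * 2 ^ r.P : ℚ) : ℝ) ≤ ((⌈r.Hq * 2 ^ r.P⌉ : ℤ) : ℝ) := by exact_mod_cast h
    push_cast at h'
    exact le_trans (mul_le_mul_of_nonneg_right hu.2 (by positivity)) h'

/-- The coefficient intervals enclose the coefficients. [folklore] -/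
theorem mem_coeffL_CI (i : Fin 9) (m : ℕ) :
    (coeffL (r.CI i) m).mem r.P (((r.CQ i).getD m 0 : ℚ) : ℝ) := by
  unfold coeffL CI
  rcases lt_or_ge m (r.CQ i).length with h | h
  · rw [List.getD_eq_getElem _ _ (by simpa using h), List.getElem_map,
      List.getD_eq_getElem _ _ h]
    exact mem_ofFrac _ _
  · rw [List.getD_eq_default _ _ (by simpa using h), List.getD_eq_default _ _ h]
    simpa using DI.mem_pt r.P 0

/-- `x̂(u) ∈ XIon V` for `u ∈ V`. [folklore] -/
theorem mem_XIon {V : DI} {u : ℝ} (hu : V.mem r.P u) (i : Fin 9) :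
    ((r.XIon V).get i).mem r.P (xh r.CQ u i) := by
  rw [XIon, Vec.get_mk', hornerL]
  have hlen : (r.CI i).length = (r.CQ i).length := by simp [CI]
  have h := mem_horner r.P (r.mem_coeffL_CI i) hu ((r.CI i).length - 1)
  have hsum : ∑ m ∈ Finset.range ((r.CI i).length - 1 + 1),
      (((r.CQ i).getD m 0 : ℚ) : ℝ) * u ^ m = xh r.CQ u i := by
    rw [xh_eq_sum, hlen]
    rcases Nat.eq_zero_or_pos (r.CQ i).length with h0 | hpos
    · have hnil : r.CQ i = [] := List.eq_nil_of_length_eq_zero h0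
      rw [h0, hnil]; simp
    · rw [Nat.sub_add_cancel hpos]
  rw [hsum] at h
  exact h

/-- `x̂'(u) = Σ_{m<DEG} (m+1) CQ_{m+1} u^m` when `deg x̂ ≤ DEG`. [folklore] -/
theorem xhd_eq_sum {i : Fin 9} (hlen : (r.CQ i).length ≤ r.DEG + 1) (u : ℝ) :
    xhd r.CQ u i = ∑ m ∈ Finset.range r.DEG,
      ((((m : ℚ) + 1) * (r.CQ i).getD (m + 1) 0 : ℚ) : ℝ) * u ^ m := by
  rw [xhd]
  have hdeg : (toPoly (r.CQ i)).natDegree ≤ r.DEG := natDegree_toPoly_le hlen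
  rcases Nat.eq_zero_or_pos r.DEG with h0 | hpos
  · rw [h0] at hdeg ⊢
    rw [Polynomial.eq_C_of_natDegree_le_zero hdeg, derivative_C]
    simp
  · have hd : (derivative (toPoly (r.CQ i))).natDegree < r.DEG :=
      lt_of_le_of_lt (natDegree_derivative_le _) (by omega)
    rw [eval_eq_sum_range' hd]
    refine Finset.sum_congr rfl fun m _ => ?_
    rw [coeff_derivative, coeff_toPoly]
    push_cast
    ring

/-- The derivative coefficient intervals enclose the derivative coefficients. [folklore] -/
theorem mem_coeffL_DIc (i : Fin 9) (m : ℕ) :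
    (coeffL (r.DIc i) m).mem r.P
      (if m < r.DEG then ((((m : ℚ) + 1) * (r.CQ i).getD (m + 1) 0 : ℚ) : ℝ) else 0) := by
  unfold coeffL DIc
  split_ifs with h
  · rw [List.getD_eq_getElem _ _ (by simpa using h), List.getElem_map, List.getElem_range]
    exact mem_ofFrac _ _
  · rw [List.getD_eq_default _ _ (by simpa using h)]
    simpa using DI.mem_pt r.P 0

/-- `x̂'(u) ∈ DXIon V` for `u ∈ V`. [folklore] -/
theorem mem_DXIon {V : DI} {u : ℝ} (hu : V.mem r.P u) {i : Fin 9}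
    (hlen : (r.CQ i).length ≤ r.DEG + 1) : ((r.DXIon V).get i).mem r.P (xhd r.CQ u i) := by
  rw [DXIon, Vec.get_mk', hornerL]
  have hlenD : (r.DIc i).length = r.DEG := by simp [DIc]
  have h := mem_horner r.P (r.mem_coeffL_DIc i) hu ((r.DIc i).length - 1)
  have hsum : ∑ m ∈ Finset.range ((r.DIc i).length - 1 + 1),
      (if m < r.DEG then ((((m : ℚ) + 1) * (r.CQ i).getD (m + 1) 0 : ℚ) : ℝ) else 0) * u ^ m =
        xhd r.CQ u i := by
    rw [r.xhd_eq_sum hlen, hlenD]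
    rcases Nat.eq_zero_or_pos r.DEG with h0 | hpos
    · rw [h0]; simp
    · rw [Nat.sub_add_cancel hpos]
      refine Finset.sum_congr rfl fun m hm => ?_
      rw [Finset.mem_range] at hm
      rw [if_pos hm]
  rw [hsum] at h
  exact h

/-! ### The Jacobian -/

/-- `J(x̂(u)) ∈ JmatI(XIon V)`. [folklore] -/
theorem mem_JI {g : GateData} {Λ : ℝ} (hU : r.cU.Mem r.P g) (hD : r.cD.Mem r.P (scaled g Λ))
    {V : DI} {u : ℝ} (hu : V.mem r.P u) (i l : Fin 9) :
    ((Tab.mk' (JmatI r.P r.cU r.cD (r.XIon V).get)).at i l).mem r.P (Jmat g Λ (xh r.CQ u) i l) := by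
  rw [Tab.at_mk']
  exact mem_JmatI hU hD (fun a => r.mem_XIon hu a) i l

/-- `Cert.hJp`: the phase row of the Jacobian over the row. [folklore] -/
theorem Jp_le {g : GateData} {Λ : ℝ} (hU : r.cU.Mem r.P g) (hD : r.cD.Mem r.P (scaled g Λ))
    {u : ℝ} (hu : u ∈ Icc 0 (r.Hq : ℝ)) (b : Fin 9) :
    |Jmat g Λ (xh r.CQ u) r.p b| ≤
      (((Tab.mk' (JmatI r.P r.cU r.cD (r.XIon r.U).get)).at r.p b).mag : ℝ) / 2 ^ r.P :=
  DI.abs_le_mag (r.mem_JI hU hD (r.mem_U hu) r.p b)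

/-! ### Sign-definiteness, the signed reciprocal and `P̃` -/

/-- A member of a sign-definite interval is at least `min |lo| |hi|` in absolute value, and nonzero.
[folklore] -/
theorem abs_ge_of_signDef {Φ : DI} (hs : signDef Φ = true) {x : ℝ} (hx : Φ.mem r.P x) :
    ((min |Φ.lo| |Φ.hi| : ℤ) : ℝ) / 2 ^ r.P ≤ |x| ∧ x ≠ 0 := by
  have hO : (0 : ℝ) < 2 ^ r.P := by positivity
  rw [signDef, Bool.or_eq_true] at hs
  obtain ⟨h1, h2⟩ := hx
  rcases hs with hs | hs
  · have hlo : 0 < Φ.lo := of_decide_eq_true hs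
    have hlo' : (0 : ℝ) < Φ.lo := by exact_mod_cast hlo
    have hxpos : 0 < x := by nlinarith
    refine ⟨?_, hxpos.ne'⟩
    rw [abs_of_pos hxpos, div_le_iff₀ hO]
    have : ((min |Φ.lo| |Φ.hi| : ℤ) : ℝ) ≤ (Φ.lo : ℝ) := by
      have : min |Φ.lo| |Φ.hi| ≤ Φ.lo := (min_le_left _ _).trans (abs_of_pos hlo).le
      exact_mod_cast this
    linarith
  · have hhi : 0 < -Φ.hi := by have := of_decide_eq_true hs; simpa [DI.neg] using this
    have hhi' : (Φ.hi : ℝ) < 0 := by exact_mod_cast (by omega : Φ.hi < 0)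
    have hxneg : x < 0 := by nlinarith
    refine ⟨?_, hxneg.ne⟩
    rw [abs_of_neg hxneg, div_le_iff₀ hO]
    have : ((min |Φ.lo| |Φ.hi| : ℤ) : ℝ) ≤ -(Φ.hi : ℝ) := by
      have : min |Φ.lo| |Φ.hi| ≤ -Φ.hi := (min_le_right _ _).trans (abs_of_neg (by omega)).le
      exact_mod_cast this
    linarith

/-- `Cert.hΦ`: the phase-speed floor over the row. [folklore] -/
theorem Philo_le (hs : signDef ((r.DXIon r.U).get r.p) = true)
    (hlen : (r.CQ r.p).length ≤ r.DEG + 1) {u : ℝ} (hu : u ∈ Icc 0 (r.Hq : ℝ)) :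
    ((r.ph'.PhiAbsLo : ℤ) : ℝ) / 2 ^ r.P ≤ |xhd r.CQ u r.p| :=
  (r.abs_ge_of_signDef hs (r.mem_DXIon (r.mem_U hu) hlen)).1

/-- The signed reciprocal encloses `1/x`. [folklore] -/
theorem mem_sInv {Φ : DI} (hs : signDef Φ = true) {x : ℝ} (hx : Φ.mem r.P x) :
    (r.sInv Φ).mem r.P x⁻¹ := by
  unfold sInv
  rw [signDef, Bool.or_eq_true] at hs
  by_cases hp : Φ.posB = true
  · rw [if_pos hp]
    have := DI.mem_inv (of_decide_eq_true hp) hx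
    simpa using this
  · rw [if_neg hp]
    have hn : Φ.neg.posB = true := by tauto
    have h1 := DI.mem_inv (of_decide_eq_true hn) (DI.mem_neg hx)
    have h2 := DI.mem_neg h1
    convert h2 using 1
    rw [one_div, inv_neg, neg_neg]

/-- `P̃(u) ∈ PT`: the lock projector with `x̂'` enclosed by `DX` (and `Φ = DX_p` sign-definite).
[folklore] -/
theorem mem_PT {DX : Vec DI 9} {d : Fin 9 → ℝ} (hDX : ∀ i, (DX.get i).mem r.P (d i))
    (hs : signDef (DX.get r.p) = true) (a b : Fin 9) :
    ((r.PT DX (r.sInv (DX.get r.p))).at a b).mem r.P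
      ((if a = b then (1 : ℝ) else 0) - d a * (if b = r.p then (d r.p)⁻¹ else 0)) := by
  rw [PT, Tab.at_mk']
  have hne : d r.p ≠ 0 := (r.abs_ge_of_signDef hs (hDX r.p)).2
  by_cases hb : b = r.p
  · subst hb
    rw [if_pos rfl]
    by_cases ha : a = r.p
    · subst ha
      simp only [if_true]
      rw [mul_inv_cancel₀ hne, sub_self]
      simpa using DI.mem_pt r.P 0
    · rw [if_neg ha, if_neg ha, if_pos rfl, zero_sub]
      exact DI.mem_neg (DI.mem_mul (hDX a) (r.mem_sInv hs (hDX r.p)))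
  · rw [if_neg hb]
    simp only [hb, if_false, mul_zero, sub_zero]
    have := mem_eyeI r.P a b
    unfold eyeI at this
    exact this

end RowData

end RowCheck

end Summit.NavierStokesRegularity.FluidComputer
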